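import Literature.Analysis.FunctionSpaces.TorusPlanarLift
import Literature.Analysis.FunctionSpaces.TorusLadyzhenskaya
import Literature.Analysis.FunctionSpaces.TorusEnstrophyOrthogonality
import HarnessLib

/-!
# Vertical slices of `T³` and the anisotropic (sliced) Ladyzhenskaya estimate

Function-space support for the weak–strong uniqueness theorem *off* the Prodi–Serrin scale of
Bardos–Lopes Filho–Niu–Nussenzveig Lopes–Titi, SIAM J. Math. Anal. 45 (2013), Thm. 3.1
(three-dimensional Leray–Hopf perturbations of `x₃`-independent, "two-and-a-half-dimensional",
Leray–Hopf solutions; used by Bardos–Titi–Wiedemann 2012, Thm. 5, for shear flows on `T³`).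
The one analytic input of that proof beyond the two-dimensional theory is the estimate of the
trilinear term obtained by integrating the **two-dimensional** Ladyzhenskaya inequality over the
horizontal slices and applying Hölder's inequality in the vertical variable (op. cit., proof of
Thm. 3.1: "We analyze the nonlinear term using the two-dimensional Ladyzhenskaya inequality in
`D` … `≤ 2^{1/4} ∫∫ ‖w‖^{1/2}_{L²(D)} ‖(∂₁,∂₂)w‖^{1/2}_{L²(D)} ‖∇w‖_{L²(D)} ‖u‖_{L⁴(D)} dx₃ ds`").
This file proves that estimate on the flat torus `T³ = UnitAddTorus (Fin 3)`, sliced along the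
third axis, for **smooth** functions (the form in which it is consumed: Fourier truncations of
Leray–Hopf solutions are trigonometric polynomials), in `ℝ≥0∞` (lower-integral) form matching
the tree's `Torus.exists_ladyzhenskaya_const` (`FunctionSpaces/TorusLadyzhenskaya`).

## Contents (all proved)

* `Torus.vpoint y s = (y₀, y₁, s)` — the point of `T³` over `y ∈ T²` at height `s`; the
  slicing calculus: `planarProj (vpoint y s) = y`, smoothness of slices of smooth functions
  (`IsSmooth.vslice`), `∂ⱼ(G(·,s)) = (∂ⱼG)(·,s)` for the planar directions
  (`partialDeriv_vslice`), vertical invariance of partial derivatives of vertically invariant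
  functions.
* Measure theory: `(s, y) ↦ vpoint y s` carries `vol_T ⊗ vol_{T²}` to `vol_{T³}`
  (`measurePreserving_vpoint`, the inverse of Mathlib's `MeasurableEquiv.piFinSuccAbove` at the
  last coordinate), Fubini along the vertical axis for lower integrals
  (`lintegral_eq_lintegral_vslice`), and integrals of vertically invariant functions.
* `Torus.ladyzhenskayaConst₂`, `Torus.anisotropicConst = ladyzhenskayaConst₂^{1/2}` — a fixed
  two-dimensional Ladyzhenskaya constant for smooth scalar functions on `T²` (a witness of
  `exists_ladyzhenskaya_const ℝ`) and the constant of the sliced estimates.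
* `Torus.lintegral_mul_mul_le_anisotropic` — **the sliced estimate**: for smooth `f g` and a
  measurable `h` independent of `x₃`,
  `∫ |f g h| ≤ C ‖f‖₂^{1/2} ‖f‖_{H¹}^{1/2} ‖g‖₂^{1/2} ‖g‖_{H¹}^{1/2} ‖h‖₂`,
  `‖f‖²_{H¹} = ∫f² + ∑ᵢ∫(∂ᵢf)²`; its dual `Torus.lintegral_mul_mul_le_anisotropic'` (`f, g`
  independent of `x₃`, `h` arbitrary), via `Torus.lintegral_mul_sq_rpow_half_le_anisotropic`
  (`‖fg‖₂ ≤ C ‖f‖₂^{1/2}‖f‖_{H¹}^{1/2}‖g‖₂^{1/2}‖g‖_{H¹}^{1/2}` for planar `f, g`, the planar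
  Ladyzhenskaya inequality seen on `T³`).
* `Torus.enorm_integral_inner_convect_le_anisotropic` (`c` independent of `x₃`) and
  `Torus.enorm_integral_inner_convect_le_anisotropic'` (`a, b` independent of `x₃`) — the
  convective form `|∫ ⟪b, (a·∇)c⟫| ≤ 9C ‖a‖₂^{1/2}‖a‖_{H¹}^{1/2}‖b‖₂^{1/2}‖b‖_{H¹}^{1/2}‖∇c‖₂`
  for smooth vector fields `T³ → ℝ³` (nine scalar pairings).

Design: everything stays on `T³` (no `T²`-valued objects leak into the statements); the `H¹`
quantities are the classical `∫‖φ‖² + ∑ᵢ∫‖∂ᵢφ‖²` of smooth fields (for trigonometric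
polynomials `∑ᵢ∫‖∂ᵢφ‖² = Torus.eGradNormSq φ`, `Torus.lintegral_sum_enorm_sq_eq_eGradNormSq`,
which consumers apply). Not here: the extension to non-smooth `H¹` fields (consumers pass to
the limit along Fourier truncations), and any statement about Navier–Stokes.

## Mathlib search

Mathlib (this pin) has Fubini for finite products (`MeasureTheory.measurePreserving_piFinSuccAbove`,
`lintegral_prod`), Hölder for lower integrals (`ENNReal.lintegral_mul_le_Lp_mul_Lq`), and the
Gagliardo–Nirenberg–Sobolev inequality on `ℝⁿ` behind the tree's torus Ladyzhenskaya inequality;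
it has no Ladyzhenskaya or anisotropic/sliced interpolation inequality (searched `Ladyzhenskaya`,
`anisotropic`, `slice` with `Sobolev`: none). In the tree: `Torus.exists_ladyzhenskaya_const`
(smooth maps `T² → F`), `exists_ladyzhenskaya_const_memLp` (`FluidPDE/NSUniqueness2DL4`, `L²`
fields on `T²`), `Torus.planarProj` / `measurePreserving_planarProj` (`TorusPlanarLift`), reused.

## References

* C. Bardos, M. C. Lopes Filho, D. Niu, H. J. Nussenzveig Lopes, E. S. Titi, *Stability of
  two-dimensional viscous incompressible flows under three-dimensional perturbations and
  inviscid symmetry breaking*, SIAM J. Math. Anal. 45 (2013) 1871–1885 = arXiv:1201.2742,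
  Thm. 3.1 and its proof. [BardosEtAl2013]
* O. A. Ladyzhenskaya, Comm. Pure Appl. Math. 12 (1959), 427–433, Lemma 1; C. Foias, O. Manley,
  R. Rosa, R. Temam, *Navier–Stokes Equations and Turbulence*, CUP 2001, App. II.A (A.47).
  [FoiasManleyRosaTemam2001]
-/

open Set Filter MeasureTheory UnitAddTorus
open scoped NNReal ENNReal InnerProductSpace Topology

noncomputable section

namespace Literature.Analysis.FunctionSpaces.Torus

/-- The flat three-torus (local notation). [folklore] -/
local notation "𝕋³" => UnitAddTorus (Fin 3)
/-- The flat two-torus (local notation). [folklore] -/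
local notation "𝕋²" => UnitAddTorus (Fin 2)
/-- `ℝ³` (local notation). [folklore] -/
local notation "E³" => EuclideanSpace ℝ (Fin 3)
/-- `ℝ²` (local notation). [folklore] -/
local notation "E²" => EuclideanSpace ℝ (Fin 2)

/-! ## Vertical slices `y ↦ F (y₀, y₁, s)` -/

/-- The point of `T³` with planar coordinates `y ∈ T²` and height `s`: `(y₀, y₁, s)`. [folklore] -/
def vpoint (y : 𝕋²) (s : UnitAddCircle) : 𝕋³ := Fin.snoc y s

/-- Planar coordinates of `vpoint y s`. [folklore] -/
@[simp]
theorem vpoint_castSucc (y : 𝕋²) (s : UnitAddCircle) (j : Fin 2) :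
    vpoint y s (Fin.castSucc j) = y j := by
  simp [vpoint]

/-- Height of `vpoint y s`. [folklore] -/
@[simp]
theorem vpoint_last (y : 𝕋²) (s : UnitAddCircle) : vpoint y s (Fin.last 2) = s :=
  Fin.snoc_last (α := fun _ => UnitAddCircle) _ _

/-- Height of `vpoint y s` (numeral form of the index). [folklore] -/
@[simp]
theorem vpoint_two (y : 𝕋²) (s : UnitAddCircle) : vpoint y s 2 = s :=
  vpoint_last y s

/-- The planar projection of `vpoint y s` is `y`. [folklore] -/
@[simp]
theorem planarProj_vpoint (y : 𝕋²) (s : UnitAddCircle) : planarProj (vpoint y s) = y := by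
  funext j
  simp

/-- Every point of `T³` is `vpoint` of its planar projection and its height. [folklore] -/
theorem vpoint_planarProj (x : 𝕋³) : vpoint (planarProj x) (x 2) = x := by
  funext i
  refine Fin.lastCases ?_ (fun j => ?_) i
  · simp [last_two_eq]
  · simp

/-- Translating the planar coordinates. [folklore] -/
theorem vpoint_add_left (y y' : 𝕋²) (s : UnitAddCircle) :
    vpoint (y + y') s = vpoint y s + vpoint y' 0 := by
  funext i
  refine Fin.lastCases ?_ (fun j => ?_) i
  · simp
  · simp

/-- Splitting a point into its planar part and its height. [folklore] -/
theorem vpoint_eq_add (y : 𝕋²) (s : UnitAddCircle) : vpoint y s = vpoint y 0 + vpoint 0 s := by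
  funext i
  refine Fin.lastCases ?_ (fun j => ?_) i
  · simp
  · simp

/-- Translating the height. [folklore] -/
theorem vpoint_add_single (y : 𝕋²) (s s' : UnitAddCircle) :
    vpoint y (s + s') = vpoint y s + Pi.single (2 : Fin 3) s' := by
  funext i
  refine Fin.lastCases ?_ (fun j => ?_) i
  · simp [last_two_eq]
  · simp [castSucc_ne_two j]

/-- `vpoint y s` is `vpoint y 0` translated by `s` along the third axis. [folklore] -/
theorem vpoint_eq_vpoint_zero_add_single (y : 𝕋²) (s : UnitAddCircle) :
    vpoint y s = vpoint y 0 + Pi.single (2 : Fin 3) s := by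
  simpa using vpoint_add_single y 0 s

/-- A function invariant under vertical translations is determined by its slice at height `0`. [folklore] -/
theorem apply_vpoint_of_forall_add_single {β : Type*} {h : 𝕋³ → β}
    (hinv : ∀ (s : UnitAddCircle) (x : 𝕋³), h (x + Pi.single (2 : Fin 3) s) = h x)
    (y : 𝕋²) (s : UnitAddCircle) : h (vpoint y s) = h (vpoint y 0) := by
  rw [vpoint_eq_vpoint_zero_add_single, hinv]

/-- A function invariant under vertical translations is the planar lift of its slice at height
`0`. [folklore] -/
theorem eq_comp_planarProj_of_forall_add_single {β : Type*} {h : 𝕋³ → β}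
    (hinv : ∀ (s : UnitAddCircle) (x : 𝕋³), h (x + Pi.single (2 : Fin 3) s) = h x) :
    h = (fun y => h (vpoint y 0)) ∘ planarProj := by
  funext x
  simp only [Function.comp_apply]
  rw [← apply_vpoint_of_forall_add_single hinv (planarProj x) (x 2), vpoint_planarProj]

/-! ## Measure theory of vertical slicing: `T³ ≅ T × T²` -/

/-- **Vertical slicing preserves volume**: `(s, y) ↦ (y₀, y₁, s)` carries `vol_T ⊗ vol_{T²}` to
`vol_{T³}` (the inverse of `MeasurableEquiv.piFinSuccAbove` at the last coordinate). [folklore] -/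
theorem measurePreserving_vpoint :
    MeasurePreserving (fun p : UnitAddCircle × 𝕋² => vpoint p.2 p.1) (volume.prod volume) volume := by
  have h1 := (measurePreserving_piFinSuccAbove (fun _ : Fin 3 => (volume : Measure UnitAddCircle))
    (Fin.last 2)).symm
  have hfun : ((MeasurableEquiv.piFinSuccAbove (fun _ : Fin 3 => UnitAddCircle) (Fin.last 2)).symm :
      UnitAddCircle × (Fin 2 → UnitAddCircle) → (Fin 3 → UnitAddCircle)) =
      fun p : UnitAddCircle × 𝕋² => vpoint p.2 p.1 := by
    funext p
    change Fin.insertNth (Fin.last 2) p.1 p.2 = vpoint p.2 p.1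
    exact Fin.insertNth_last' _ _
  rw [hfun] at h1
  simpa [MeasureTheory.volume_pi] using h1

/-- Joint measurability of a sliced measurable function. [folklore] -/
theorem measurable_vslice_uncurry {β : Type*} [MeasurableSpace β] {F : 𝕋³ → β} (hF : Measurable F) :
    Measurable fun p : UnitAddCircle × 𝕋² => F (vpoint p.2 p.1) :=
  hF.comp measurePreserving_vpoint.measurable

/-- **Fubini along the vertical axis** for lower integrals: `∫⁻_{T³} F = ∫⁻_T ∫⁻_{T²} F(y₀,y₁,s) dy ds`. [folklore] -/
theorem lintegral_eq_lintegral_vslice {F : 𝕋³ → ℝ≥0∞} (hF : Measurable F) :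
    ∫⁻ x, F x = ∫⁻ s, ∫⁻ y, F (vpoint y s) := by
  have h := measurePreserving_vpoint.lintegral_comp hF
  rw [lintegral_prod _ (measurable_vslice_uncurry hF).aemeasurable] at h
  exact h.symm

/-- Measurability in the height of the slice integrals `s ↦ ∫⁻_{T²} F(y, s) dy`. [folklore] -/
theorem measurable_lintegral_vslice {F : 𝕋³ → ℝ≥0∞} (hF : Measurable F) :
    Measurable fun s : UnitAddCircle => ∫⁻ y, F (vpoint y s) :=
  (measurable_vslice_uncurry hF).lintegral_prod_right'

/-- The slice `y ↦ (y, s)` at a fixed height is measurable. [folklore] -/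
theorem measurable_vpoint_left (s : UnitAddCircle) : Measurable fun y : 𝕋² => vpoint y s :=
  measurePreserving_vpoint.measurable.comp (measurable_const.prodMk measurable_id)

/-- Integrals over `T³` of vertically invariant functions are integrals over one slice. [folklore] -/
theorem lintegral_eq_lintegral_vslice_zero_of_forall_add_single {F : 𝕋³ → ℝ≥0∞} (hF : Measurable F)
    (hinv : ∀ (s : UnitAddCircle) (x : 𝕋³), F (x + Pi.single (2 : Fin 3) s) = F x) :
    ∫⁻ x, F x = ∫⁻ y, F (vpoint y 0) := by
  rw [lintegral_eq_lintegral_vslice hF]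
  simp_rw [apply_vpoint_of_forall_add_single hinv]
  rw [lintegral_const, measure_univ, mul_one]

/-! ## Calculus of vertical slices -/

section Calculus

variable {F : Type*} [NormedAddCommGroup F] [NormedSpace ℝ F]

/-- The linear model `ℝ² → ℝ³`, `z ↦ (z₀, z₁, 0)`, of the slice embedding at height `0`. [folklore] -/
def vsliceE : E² →L[ℝ] E³ := planarEmbed.comp (ContinuousLinearMap.inl ℝ E² ℝ)

/-- Coordinates of `vsliceE`. [folklore] -/
theorem vsliceE_apply (z : E²) : vsliceE z = planarEmbed (z, 0) := rfl

/-- The covering map intertwines `vsliceE` with the slice at height `0`. [folklore] -/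
theorem proj_vsliceE (z : E²) : proj (vsliceE z) = vpoint (proj z) 0 := by
  funext i
  refine Fin.lastCases ?_ (fun j => ?_) i
  · rw [vsliceE_apply, proj_apply, last_two_eq, planarEmbed_apply_two]
    simp [last_two_eq.symm]
  · rw [vsliceE_apply, proj_apply, planarEmbed_apply_castSucc]
    simp

omit [NormedAddCommGroup F] [NormedSpace ℝ F] in
/-- The lift of a slice is the lift of a translate composed with `vsliceE`. [folklore] -/
theorem lift_vslice (G : 𝕋³ → F) (s : UnitAddCircle) :
    lift (fun y : 𝕋² => G (vpoint y s)) = lift (fun x => G (x + vpoint 0 s)) ∘ vsliceE := by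
  funext z
  simp only [lift_apply, Function.comp_apply, proj_vsliceE]
  congr 1
  exact vpoint_eq_add _ _

/-- **Slices of smooth functions are smooth.** [folklore] -/
theorem IsSmooth.vslice {G : 𝕋³ → F} (hG : IsSmooth G) (s : UnitAddCircle) :
    IsSmooth fun y : 𝕋² => G (vpoint y s) := by
  unfold IsSmooth
  rw [lift_vslice]
  exact (hG.comp_add_right (vpoint 0 s)).comp vsliceE.contDiff

/-- **Planar partial derivatives commute with slicing**: `∂ⱼ (G(·, s)) = (∂ⱼ G)(·, s)`, `j = 0, 1`
(pure rewriting of the difference quotients; no differentiability needed). [folklore] -/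
theorem partialDeriv_vslice (G : 𝕋³ → F) (s : UnitAddCircle) (j : Fin 2) :
    partialDeriv j (fun y : 𝕋² => G (vpoint y s)) = fun y => partialDeriv (Fin.castSucc j) G (vpoint y s) := by
  funext y
  unfold partialDeriv lineDeriv
  congr 1
  funext t
  dsimp only
  rw [vpoint_add_left]
  congr 2
  funext i
  refine Fin.lastCases ?_ (fun i => ?_) i
  · simp [last_two_eq, proj_apply, (castSucc_ne_two j).symm]
  · simp [proj_apply, Fin.castSucc_inj]

end Calculus

/-! ## Cauchy–Schwarz for lower integrals -/

/-- **Cauchy–Schwarz for lower integrals**: `∫⁻ f g ≤ (∫⁻ f²)^{1/2} (∫⁻ g²)^{1/2}` (Hölder with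
`p = q = 2`, Mathlib's `ENNReal.lintegral_mul_le_Lp_mul_Lq`). [folklore] -/
theorem lintegral_mul_le_sqrt_mul_sqrt {α : Type*} [MeasurableSpace α] {μ : Measure α}
    {f g : α → ℝ≥0∞} (hf : AEMeasurable f μ) (hg : AEMeasurable g μ) :
    ∫⁻ a, f a * g a ∂μ ≤ (∫⁻ a, f a ^ 2 ∂μ) ^ (1 / 2 : ℝ) * (∫⁻ a, g a ^ 2 ∂μ) ^ (1 / 2 : ℝ) := by
  have hpq : (2 : ℝ).HolderConjugate 2 := by
    rw [Real.holderConjugate_iff]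
    norm_num
  have h := ENNReal.lintegral_mul_le_Lp_mul_Lq μ hpq hf hg
  simp only [Pi.mul_apply, ENNReal.rpow_two] at h
  exact h

/-! ## The constants -/

/-- **The two-dimensional Ladyzhenskaya constant** (a fixed witness of
`Torus.exists_ladyzhenskaya_const ℝ`): a finite `C₂` with
`∫ φ⁴ ≤ C₂ (∫ φ²)(∫ φ² + ∑ᵢ ∫ (∂ᵢφ)²)` for every smooth `φ : T² → ℝ` (Ladyzhenskaya 1959;
Foias–Manley–Rosa–Temam 2001, App. II.A (A.47)). [cite: FoiasManleyRosaTemam2001, App. II.A (A.47)] -/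
def ladyzhenskayaConst₂ : ℝ≥0∞ :=
  Classical.choose (exists_ladyzhenskaya_const ℝ)

/-- The defining property of `ladyzhenskayaConst₂`. [cite: FoiasManleyRosaTemam2001, App. II.A (A.47)] -/
theorem ladyzhenskayaConst₂_spec :
    ladyzhenskayaConst₂ ≠ ⊤ ∧ ∀ φ : 𝕋² → ℝ, IsSmooth φ →
      ∫⁻ x, ‖φ x‖ₑ ^ 4 ≤ ladyzhenskayaConst₂ * ((∫⁻ x, ‖φ x‖ₑ ^ 2) *
        ((∫⁻ x, ‖φ x‖ₑ ^ 2) + ∑ i, ∫⁻ x, ‖partialDeriv i φ x‖ₑ ^ 2)) :=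
  Classical.choose_spec (exists_ladyzhenskaya_const ℝ)

/-- **The anisotropic Ladyzhenskaya constant** `C = C₂^{1/2}`, the constant of the sliced
estimates below. [folklore] -/
def anisotropicConst : ℝ≥0∞ :=
  ladyzhenskayaConst₂ ^ (1 / 2 : ℝ)

/-- The anisotropic Ladyzhenskaya constant is finite. [folklore] -/
theorem anisotropicConst_ne_top : anisotropicConst ≠ ⊤ :=
  ENNReal.rpow_ne_top_of_nonneg (by norm_num) ladyzhenskayaConst₂_spec.1

/-- The anisotropic Ladyzhenskaya constant is finite. [folklore] -/
theorem anisotropicConst_lt_top : anisotropicConst < ⊤ :=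
  anisotropicConst_ne_top.lt_top

/-! ## The anisotropic (sliced) Ladyzhenskaya estimate -/

/-- **The anisotropic Ladyzhenskaya estimate on `T³`** (the inequality behind
Bardos–Lopes Filho–Niu–Nussenzveig Lopes–Titi 2013, proof of Thm. 3.1, display after "We analyze
the nonlinear term using the two-dimensional Ladyzhenskaya inequality in `D`": the integral over
the height `x₃` of the two-dimensional Ladyzhenskaya inequality on horizontal slices, followed by
Hölder's inequality in `x₃`). With the finite constant `C = anisotropicConst`, for all smooth
`f g : T³ → ℝ` and measurable `h : T³ → ℝ` independent of the third coordinate,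
`∫ |f g h| ≤ C ‖f‖₂^{1/2} ‖f‖_{H¹}^{1/2} ‖g‖₂^{1/2} ‖g‖_{H¹}^{1/2} ‖h‖₂`,
`‖f‖²_{H¹} = ∫ f² + ∑ᵢ ∫ (∂ᵢf)²` (lower integrals; the full gradient is allowed on the right
although only the horizontal one is used). Proof: Fubini `T³ = T × T²` along the third axis,
`|∫_{T²} f_s g_s h₀| ≤ ‖f_s‖₄ ‖g_s‖₄ ‖h₀‖₂` on each slice, the two-dimensional inequality
`‖φ‖₄⁴ ≤ C₂ ‖φ‖₂² ‖φ‖²_{H¹(T²)}` for the smooth slices `f_s`, `g_s`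
(`Torus.exists_ladyzhenskaya_const`), and Cauchy–Schwarz in `s` twice; `C = C₂^{1/2}`
(`anisotropicConst`). Only measurability is required of `h`. [cite: BardosEtAl2013, Thm. 3.1 (proof)] -/
theorem lintegral_mul_mul_le_anisotropic {f g h : 𝕋³ → ℝ} (hf : IsSmooth f) (hg : IsSmooth g)
    (hh : Measurable h) (hinv : ∀ (s : UnitAddCircle) (x : 𝕋³), h (x + Pi.single (2 : Fin 3) s) = h x) :
    ∫⁻ x, ‖f x‖ₑ * ‖g x‖ₑ * ‖h x‖ₑ ≤
      anisotropicConst * ((∫⁻ x, ‖f x‖ₑ ^ 2) ^ (1 / 4 : ℝ) *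
            ((∫⁻ x, ‖f x‖ₑ ^ 2) + ∑ i, ∫⁻ x, ‖partialDeriv i f x‖ₑ ^ 2) ^ (1 / 4 : ℝ)) *
          ((∫⁻ x, ‖g x‖ₑ ^ 2) ^ (1 / 4 : ℝ) *
            ((∫⁻ x, ‖g x‖ₑ ^ 2) + ∑ i, ∫⁻ x, ‖partialDeriv i g x‖ₑ ^ 2) ^ (1 / 4 : ℝ)) *
          (∫⁻ x, ‖h x‖ₑ ^ 2) ^ (1 / 2 : ℝ) := by
  obtain ⟨hC₂, hLad⟩ := ladyzhenskayaConst₂_spec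
  set C₂ := ladyzhenskayaConst₂ with hC₂def
  rw [anisotropicConst]
  -- ### notation: slice norms
  set A : (𝕋³ → ℝ) → ℝ≥0∞ := fun φ => ∫⁻ x, ‖φ x‖ₑ ^ 2 with hA
  set B : (𝕋³ → ℝ) → ℝ≥0∞ := fun φ => (∫⁻ x, ‖φ x‖ₑ ^ 2) + ∑ i, ∫⁻ x, ‖partialDeriv i φ x‖ₑ ^ 2
    with hB
  set a : (𝕋³ → ℝ) → UnitAddCircle → ℝ≥0∞ := fun φ s => ∫⁻ y, ‖φ (vpoint y s)‖ₑ ^ 2 with ha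
  set b : (𝕋³ → ℝ) → UnitAddCircle → ℝ≥0∞ := fun φ s =>
    (∫⁻ y, ‖φ (vpoint y s)‖ₑ ^ 2) +
      ∑ i : Fin 2, ∫⁻ y, ‖partialDeriv (Fin.castSucc i) φ (vpoint y s)‖ₑ ^ 2 with hb
  set H : ℝ≥0∞ := ∫⁻ x, ‖h x‖ₑ ^ 2 with hH
  -- ### measurability
  have hmeas : ∀ {φ : 𝕋³ → ℝ}, IsSmooth φ → Measurable fun x => ‖φ x‖ₑ := fun hφ =>
    hφ.continuous.measurable.enorm
  have hmeas2 : ∀ {φ : 𝕋³ → ℝ}, IsSmooth φ → Measurable fun x => ‖φ x‖ₑ ^ 2 := fun hφ =>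
    (hmeas hφ).pow_const 2
  -- ### the slice inequality
  have hslice : ∀ s, ∫⁻ y, ‖f (vpoint y s)‖ₑ * ‖g (vpoint y s)‖ₑ * ‖h (vpoint y 0)‖ₑ ≤
      C₂ ^ (1 / 2 : ℝ) * ((a f s * b f s) ^ (1 / 4 : ℝ) * (a g s * b g s) ^ (1 / 4 : ℝ)) *
        H ^ (1 / 2 : ℝ) := by
    intro s
    -- Ladyzhenskaya for the two slices
    have hL : ∀ {φ : 𝕋³ → ℝ}, IsSmooth φ → ∫⁻ y, ‖φ (vpoint y s)‖ₑ ^ 4 ≤ C₂ * (a φ s * b φ s) := by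
      intro φ hφ
      have h1 := hLad (fun y => φ (vpoint y s)) (hφ.vslice s)
      simp only [partialDeriv_vslice] at h1
      exact h1
    have hmf : ∀ {φ : 𝕋³ → ℝ}, IsSmooth φ → Measurable fun y : 𝕋² => ‖φ (vpoint y s)‖ₑ := fun hφ =>
      (hmeas hφ).comp (measurable_vpoint_left s)
    -- Cauchy–Schwarz: split off `h`
    have hH0 : ∫⁻ y, ‖h (vpoint y 0)‖ₑ ^ 2 = H :=
      (lintegral_eq_lintegral_vslice_zero_of_forall_add_single (hh.enorm.pow_const 2) fun s x => by
        rw [hinv]).symm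
    have step1 : ∫⁻ y, ‖f (vpoint y s)‖ₑ * ‖g (vpoint y s)‖ₑ * ‖h (vpoint y 0)‖ₑ ≤
        (∫⁻ y, (‖f (vpoint y s)‖ₑ * ‖g (vpoint y s)‖ₑ) ^ 2) ^ (1 / 2 : ℝ) * H ^ (1 / 2 : ℝ) := by
      rw [← hH0]
      exact lintegral_mul_le_sqrt_mul_sqrt ((hmf hf).mul (hmf hg)).aemeasurable
        (hh.enorm.comp (measurable_vpoint_left 0)).aemeasurable
    -- Cauchy–Schwarz: `∫ f² g² ≤ ‖f‖₄² ‖g‖₄²`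
    have step2 : ∫⁻ y, (‖f (vpoint y s)‖ₑ * ‖g (vpoint y s)‖ₑ) ^ 2 ≤
        (C₂ * (a f s * b f s)) ^ (1 / 2 : ℝ) * (C₂ * (a g s * b g s)) ^ (1 / 2 : ℝ) := by
      calc ∫⁻ y, (‖f (vpoint y s)‖ₑ * ‖g (vpoint y s)‖ₑ) ^ 2
          = ∫⁻ y, ‖f (vpoint y s)‖ₑ ^ 2 * ‖g (vpoint y s)‖ₑ ^ 2 :=
            lintegral_congr fun y => by rw [mul_pow]
        _ ≤ (∫⁻ y, (‖f (vpoint y s)‖ₑ ^ 2) ^ 2) ^ (1 / 2 : ℝ) *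
              (∫⁻ y, (‖g (vpoint y s)‖ₑ ^ 2) ^ 2) ^ (1 / 2 : ℝ) :=
            lintegral_mul_le_sqrt_mul_sqrt ((hmf hf).pow_const 2).aemeasurable
              ((hmf hg).pow_const 2).aemeasurable
        _ = (∫⁻ y, ‖f (vpoint y s)‖ₑ ^ 4) ^ (1 / 2 : ℝ) * (∫⁻ y, ‖g (vpoint y s)‖ₑ ^ 4) ^ (1 / 2 : ℝ) := by
            simp_rw [← pow_mul]
        _ ≤ (C₂ * (a f s * b f s)) ^ (1 / 2 : ℝ) * (C₂ * (a g s * b g s)) ^ (1 / 2 : ℝ) := by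
            gcongr
            · exact hL hf
            · exact hL hg
    -- combine
    have step3 : ∀ x y : ℝ≥0∞, ((C₂ * x) ^ (1 / 2 : ℝ) * (C₂ * y) ^ (1 / 2 : ℝ)) ^ (1 / 2 : ℝ) =
        C₂ ^ (1 / 2 : ℝ) * (x ^ (1 / 4 : ℝ) * y ^ (1 / 4 : ℝ)) := by
      intro x y
      rw [← ENNReal.mul_rpow_of_nonneg _ _ (by norm_num : (0 : ℝ) ≤ 1 / 2), ← ENNReal.rpow_mul,
        show (1 / 2 : ℝ) * (1 / 2) = 1 / 4 by norm_num,
        show C₂ * x * (C₂ * y) = C₂ ^ 2 * (x * y) by ring,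
        ENNReal.mul_rpow_of_nonneg _ _ (by norm_num : (0 : ℝ) ≤ 1 / 4),
        ENNReal.mul_rpow_of_nonneg _ _ (by norm_num : (0 : ℝ) ≤ 1 / 4)]
      congr 1
      rw [← ENNReal.rpow_natCast, ← ENNReal.rpow_mul]
      norm_num
    calc ∫⁻ y, ‖f (vpoint y s)‖ₑ * ‖g (vpoint y s)‖ₑ * ‖h (vpoint y 0)‖ₑ
        ≤ (∫⁻ y, (‖f (vpoint y s)‖ₑ * ‖g (vpoint y s)‖ₑ) ^ 2) ^ (1 / 2 : ℝ) * H ^ (1 / 2 : ℝ) := step1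
      _ ≤ ((C₂ * (a f s * b f s)) ^ (1 / 2 : ℝ) * (C₂ * (a g s * b g s)) ^ (1 / 2 : ℝ)) ^ (1 / 2 : ℝ) *
            H ^ (1 / 2 : ℝ) := by
          gcongr
      _ = _ := by rw [step3]
  -- ### integrate the slice inequality over the height
  have hLHS : ∫⁻ x, ‖f x‖ₑ * ‖g x‖ₑ * ‖h x‖ₑ =
      ∫⁻ s, ∫⁻ y, ‖f (vpoint y s)‖ₑ * ‖g (vpoint y s)‖ₑ * ‖h (vpoint y 0)‖ₑ := by
    have hm : Measurable fun x => ‖f x‖ₑ * ‖g x‖ₑ * ‖h x‖ₑ :=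
      ((hmeas hf).mul (hmeas hg)).mul hh.enorm
    rw [lintegral_eq_lintegral_vslice hm]
    simp_rw [apply_vpoint_of_forall_add_single hinv]
  -- measurability of the slice norms in the height
  have ha_meas : ∀ {φ : 𝕋³ → ℝ}, IsSmooth φ → Measurable (a φ) := fun hφ =>
    measurable_lintegral_vslice (hmeas2 hφ)
  have hb_meas : ∀ {φ : 𝕋³ → ℝ}, IsSmooth φ → Measurable (b φ) := by
    intro φ hφ
    refine (measurable_lintegral_vslice (hmeas2 hφ)).add (Finset.measurable_sum _ fun i _ => ?_)
    exact measurable_lintegral_vslice (hmeas2 (hφ.partialDeriv _))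
  -- Fubini for the slice norms
  have ha_int : ∀ {φ : 𝕋³ → ℝ}, IsSmooth φ → ∫⁻ s, a φ s = A φ := fun hφ =>
    (lintegral_eq_lintegral_vslice (hmeas2 hφ)).symm
  have hb_int : ∀ {φ : 𝕋³ → ℝ}, IsSmooth φ → ∫⁻ s, b φ s ≤ B φ := by
    intro φ hφ
    have h1 : ∫⁻ s, b φ s = A φ + ∑ i : Fin 2, ∫⁻ x, ‖partialDeriv (Fin.castSucc i) φ x‖ₑ ^ 2 := by
      rw [hb]
      dsimp only
      rw [lintegral_add_left (measurable_lintegral_vslice (hmeas2 hφ)),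
        lintegral_finsetSum _ fun i _ => (measurable_lintegral_vslice (hmeas2 (hφ.partialDeriv _))),
        ← ha_int hφ]
      congr 1
      exact Finset.sum_congr rfl fun i _ =>
        (lintegral_eq_lintegral_vslice (hmeas2 (hφ.partialDeriv _))).symm
    rw [h1, hB]
    dsimp only
    gcongr
    rw [Fin.sum_univ_castSucc (f := fun i : Fin 3 => ∫⁻ x, ‖partialDeriv i φ x‖ₑ ^ 2)]
    exact le_self_add
  -- Cauchy–Schwarz in the height, twice
  have hCS : ∀ {φ : 𝕋³ → ℝ}, IsSmooth φ →
      ∫⁻ s, (a φ s * b φ s) ^ (1 / 2 : ℝ) ≤ A φ ^ (1 / 2 : ℝ) * B φ ^ (1 / 2 : ℝ) := by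
    intro φ hφ
    calc ∫⁻ s, (a φ s * b φ s) ^ (1 / 2 : ℝ) = ∫⁻ s, a φ s ^ (1 / 2 : ℝ) * b φ s ^ (1 / 2 : ℝ) :=
          lintegral_congr fun s => ENNReal.mul_rpow_of_nonneg _ _ (by norm_num)
      _ ≤ (∫⁻ s, (a φ s ^ (1 / 2 : ℝ)) ^ 2) ^ (1 / 2 : ℝ) * (∫⁻ s, (b φ s ^ (1 / 2 : ℝ)) ^ 2) ^ (1 / 2 : ℝ) :=
          lintegral_mul_le_sqrt_mul_sqrt ((ha_meas hφ).pow_const _).aemeasurable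
            ((hb_meas hφ).pow_const _).aemeasurable
      _ = (∫⁻ s, a φ s) ^ (1 / 2 : ℝ) * (∫⁻ s, b φ s) ^ (1 / 2 : ℝ) := by
          have hsq : ∀ x : ℝ≥0∞, (x ^ (1 / 2 : ℝ)) ^ 2 = x := fun x => by
            rw [← ENNReal.rpow_two, ← ENNReal.rpow_mul]
            norm_num
          simp_rw [hsq]
      _ ≤ A φ ^ (1 / 2 : ℝ) * B φ ^ (1 / 2 : ℝ) := by
          rw [ha_int hφ]
          gcongr
          exact hb_int hφ
  have hCS2 : ∫⁻ s, (a f s * b f s) ^ (1 / 4 : ℝ) * (a g s * b g s) ^ (1 / 4 : ℝ) ≤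
      (A f ^ (1 / 4 : ℝ) * B f ^ (1 / 4 : ℝ)) * (A g ^ (1 / 4 : ℝ) * B g ^ (1 / 4 : ℝ)) := by
    have hq : ∀ x : ℝ≥0∞, (x ^ (1 / 4 : ℝ)) ^ 2 = x ^ (1 / 2 : ℝ) := fun x => by
      rw [← ENNReal.rpow_two, ← ENNReal.rpow_mul]
      norm_num
    have hq' : ∀ x y : ℝ≥0∞, (x ^ (1 / 2 : ℝ) * y ^ (1 / 2 : ℝ)) ^ (1 / 2 : ℝ) = x ^ (1 / 4 : ℝ) * y ^ (1 / 4 : ℝ) :=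
      fun x y => by
        rw [ENNReal.mul_rpow_of_nonneg _ _ (by norm_num : (0 : ℝ) ≤ 1 / 2), ← ENNReal.rpow_mul,
          ← ENNReal.rpow_mul]
        norm_num
    calc ∫⁻ s, (a f s * b f s) ^ (1 / 4 : ℝ) * (a g s * b g s) ^ (1 / 4 : ℝ)
        ≤ (∫⁻ s, ((a f s * b f s) ^ (1 / 4 : ℝ)) ^ 2) ^ (1 / 2 : ℝ) *
            (∫⁻ s, ((a g s * b g s) ^ (1 / 4 : ℝ)) ^ 2) ^ (1 / 2 : ℝ) :=
          lintegral_mul_le_sqrt_mul_sqrt (((ha_meas hf).mul (hb_meas hf)).pow_const _).aemeasurable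
            (((ha_meas hg).mul (hb_meas hg)).pow_const _).aemeasurable
      _ = (∫⁻ s, (a f s * b f s) ^ (1 / 2 : ℝ)) ^ (1 / 2 : ℝ) * (∫⁻ s, (a g s * b g s) ^ (1 / 2 : ℝ)) ^ (1 / 2 : ℝ) := by
          simp_rw [hq]
      _ ≤ (A f ^ (1 / 2 : ℝ) * B f ^ (1 / 2 : ℝ)) ^ (1 / 2 : ℝ) * (A g ^ (1 / 2 : ℝ) * B g ^ (1 / 2 : ℝ)) ^ (1 / 2 : ℝ) := by
          gcongr
          · exact hCS hf
          · exact hCS hg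
      _ = _ := by rw [hq', hq']
  -- ### assemble
  calc ∫⁻ x, ‖f x‖ₑ * ‖g x‖ₑ * ‖h x‖ₑ
      = ∫⁻ s, ∫⁻ y, ‖f (vpoint y s)‖ₑ * ‖g (vpoint y s)‖ₑ * ‖h (vpoint y 0)‖ₑ := hLHS
    _ ≤ ∫⁻ s, C₂ ^ (1 / 2 : ℝ) * ((a f s * b f s) ^ (1 / 4 : ℝ) * (a g s * b g s) ^ (1 / 4 : ℝ)) *
          H ^ (1 / 2 : ℝ) := lintegral_mono hslice
    _ = C₂ ^ (1 / 2 : ℝ) * (∫⁻ s, (a f s * b f s) ^ (1 / 4 : ℝ) * (a g s * b g s) ^ (1 / 4 : ℝ)) *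
          H ^ (1 / 2 : ℝ) := by
        have hm2 : Measurable fun s => (a f s * b f s) ^ (1 / 4 : ℝ) * (a g s * b g s) ^ (1 / 4 : ℝ) :=
          (((ha_meas hf).mul (hb_meas hf)).pow_const _).mul (((ha_meas hg).mul (hb_meas hg)).pow_const _)
        rw [lintegral_mul_const _ (hm2.const_mul _), lintegral_const_mul _ hm2]
    _ ≤ C₂ ^ (1 / 2 : ℝ) * ((A f ^ (1 / 4 : ℝ) * B f ^ (1 / 4 : ℝ)) * (A g ^ (1 / 4 : ℝ) * B g ^ (1 / 4 : ℝ))) *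
          H ^ (1 / 2 : ℝ) := by
        gcongr
    _ = _ := by
        simp only [hA, hB]
        ring

/-! ## The dual form: two invariant factors -/

/-- Smooth functions on `T³` have finite `∫ φ²` (lower integral). [folklore] -/
theorem lintegral_enorm_sq_lt_top_of_isSmooth {φ : 𝕋³ → ℝ} (hφ : IsSmooth φ) :
    ∫⁻ x, ‖φ x‖ₑ ^ 2 < ⊤ := by
  have h := lintegral_rpow_enorm_lt_top_of_eLpNorm_lt_top two_ne_zero ENNReal.ofNat_ne_top
    (hφ.memLp 2).eLpNorm_lt_top
  simpa only [ENNReal.toReal_ofNat, ENNReal.rpow_ofNat] using h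

/-- **Products of two vertically invariant smooth functions**:
`‖f g‖₂ ≤ C ‖f‖₂^{1/2}‖f‖_{H¹}^{1/2}‖g‖₂^{1/2}‖g‖_{H¹}^{1/2}` for smooth `f, g : T³ → ℝ`
independent of the third coordinate — the two-dimensional Ladyzhenskaya inequality for planar
functions viewed on `T³`, obtained from `lintegral_mul_mul_le_anisotropic` with `h = f g` by
cancelling one factor `‖f g‖₂` (Bardos–Lopes Filho–Niu–Nussenzveig Lopes–Titi 2013, proof of
Thm. 3.1, last display: "`∫ ‖u‖₄⁴ ≤ 2 ∫ ‖u‖₂² ‖∇u‖₂²`" for the `x₃`-independent solution). [cite: BardosEtAl2013, Thm. 3.1 (proof)] -/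
theorem lintegral_mul_sq_rpow_half_le_anisotropic {f g : 𝕋³ → ℝ} (hf : IsSmooth f) (hg : IsSmooth g)
    (hfinv : ∀ (s : UnitAddCircle) (x : 𝕋³), f (x + Pi.single (2 : Fin 3) s) = f x)
    (hginv : ∀ (s : UnitAddCircle) (x : 𝕋³), g (x + Pi.single (2 : Fin 3) s) = g x) :
    (∫⁻ x, ‖f x * g x‖ₑ ^ 2) ^ (1 / 2 : ℝ) ≤
      anisotropicConst * ((∫⁻ x, ‖f x‖ₑ ^ 2) ^ (1 / 4 : ℝ) *
            ((∫⁻ x, ‖f x‖ₑ ^ 2) + ∑ i, ∫⁻ x, ‖partialDeriv i f x‖ₑ ^ 2) ^ (1 / 4 : ℝ)) *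
          ((∫⁻ x, ‖g x‖ₑ ^ 2) ^ (1 / 4 : ℝ) *
            ((∫⁻ x, ‖g x‖ₑ ^ 2) + ∑ i, ∫⁻ x, ‖partialDeriv i g x‖ₑ ^ 2) ^ (1 / 4 : ℝ)) := by
  have hfg : IsSmooth fun x => f x * g x := hf.smul' hg
  have hinv : ∀ (s : UnitAddCircle) (x : 𝕋³), f (x + Pi.single (2 : Fin 3) s) * g (x + Pi.single (2 : Fin 3) s) =
      f x * g x := fun s x => by rw [hfinv, hginv]
  have h := lintegral_mul_mul_le_anisotropic hf hg hfg.continuous.measurable hinv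
  set P : ℝ≥0∞ := ∫⁻ x, ‖f x * g x‖ₑ ^ 2 with hP
  set K : ℝ≥0∞ := anisotropicConst * ((∫⁻ x, ‖f x‖ₑ ^ 2) ^ (1 / 4 : ℝ) *
      ((∫⁻ x, ‖f x‖ₑ ^ 2) + ∑ i, ∫⁻ x, ‖partialDeriv i f x‖ₑ ^ 2) ^ (1 / 4 : ℝ)) *
    ((∫⁻ x, ‖g x‖ₑ ^ 2) ^ (1 / 4 : ℝ) *
      ((∫⁻ x, ‖g x‖ₑ ^ 2) + ∑ i, ∫⁻ x, ‖partialDeriv i g x‖ₑ ^ 2) ^ (1 / 4 : ℝ)) with hK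
  have hPeq : ∫⁻ x, ‖f x‖ₑ * ‖g x‖ₑ * ‖f x * g x‖ₑ = P := by
    rw [hP]
    refine lintegral_congr fun x => ?_
    rw [enorm_mul, sq]
  rw [hPeq] at h
  -- `P ≤ K P^{1/2}` with `P < ∞` forces `P^{1/2} ≤ K`
  have hPtop : P < ⊤ := lintegral_enorm_sq_lt_top_of_isSmooth hfg
  have hhalf : P = P ^ (1 / 2 : ℝ) * P ^ (1 / 2 : ℝ) := by
    rw [← ENNReal.rpow_add_of_nonneg _ _ (by norm_num) (by norm_num)]
    norm_num
  by_cases hP0 : P ^ (1 / 2 : ℝ) = 0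
  · rw [hP0]; exact zero_le
  have hPt : P ^ (1 / 2 : ℝ) ≠ ⊤ := ENNReal.rpow_ne_top_of_nonneg (by norm_num) hPtop.ne
  have key : P ^ (1 / 2 : ℝ) * P ^ (1 / 2 : ℝ) ≤ K * P ^ (1 / 2 : ℝ) := by
    calc P ^ (1 / 2 : ℝ) * P ^ (1 / 2 : ℝ) = P := hhalf.symm
      _ ≤ K * P ^ (1 / 2 : ℝ) := h
  exact (ENNReal.mul_le_mul_iff_left hP0 hPt).1 key

/-- **The dual sliced estimate**: for smooth `f, g : T³ → ℝ` independent of the third coordinate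
and any measurable `h`,
`∫ |f g h| ≤ C ‖f‖₂^{1/2}‖f‖_{H¹}^{1/2}‖g‖₂^{1/2}‖g‖_{H¹}^{1/2}‖h‖₂` (Cauchy–Schwarz and
`lintegral_mul_sq_rpow_half_le_anisotropic`). [cite: BardosEtAl2013, Thm. 3.1 (proof)] -/
theorem lintegral_mul_mul_le_anisotropic' {f g h : 𝕋³ → ℝ} (hf : IsSmooth f) (hg : IsSmooth g)
    (hfinv : ∀ (s : UnitAddCircle) (x : 𝕋³), f (x + Pi.single (2 : Fin 3) s) = f x)
    (hginv : ∀ (s : UnitAddCircle) (x : 𝕋³), g (x + Pi.single (2 : Fin 3) s) = g x)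
    (hh : Measurable h) :
    ∫⁻ x, ‖f x‖ₑ * ‖g x‖ₑ * ‖h x‖ₑ ≤
      anisotropicConst * ((∫⁻ x, ‖f x‖ₑ ^ 2) ^ (1 / 4 : ℝ) *
            ((∫⁻ x, ‖f x‖ₑ ^ 2) + ∑ i, ∫⁻ x, ‖partialDeriv i f x‖ₑ ^ 2) ^ (1 / 4 : ℝ)) *
          ((∫⁻ x, ‖g x‖ₑ ^ 2) ^ (1 / 4 : ℝ) *
            ((∫⁻ x, ‖g x‖ₑ ^ 2) + ∑ i, ∫⁻ x, ‖partialDeriv i g x‖ₑ ^ 2) ^ (1 / 4 : ℝ)) *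
          (∫⁻ x, ‖h x‖ₑ ^ 2) ^ (1 / 2 : ℝ) := by
  have hmeas : Measurable fun x => ‖f x‖ₑ * ‖g x‖ₑ :=
    hf.continuous.measurable.enorm.mul hg.continuous.measurable.enorm
  calc ∫⁻ x, ‖f x‖ₑ * ‖g x‖ₑ * ‖h x‖ₑ
      ≤ (∫⁻ x, (‖f x‖ₑ * ‖g x‖ₑ) ^ 2) ^ (1 / 2 : ℝ) * (∫⁻ x, ‖h x‖ₑ ^ 2) ^ (1 / 2 : ℝ) :=
        lintegral_mul_le_sqrt_mul_sqrt hmeas.aemeasurable hh.enorm.aemeasurable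
    _ = (∫⁻ x, ‖f x * g x‖ₑ ^ 2) ^ (1 / 2 : ℝ) * (∫⁻ x, ‖h x‖ₑ ^ 2) ^ (1 / 2 : ℝ) := by
        congr 2
        exact lintegral_congr fun x => by rw [enorm_mul]
    _ ≤ _ := by
        gcongr
        exact lintegral_mul_sq_rpow_half_le_anisotropic hf hg hfinv hginv

/-! ## The trilinear (convective) form of the estimates for vector fields -/

section Trilinear

/-- Partial derivatives of a vertically invariant function are vertically invariant (pure
rewriting of the difference quotients). [folklore] -/
theorem partialDeriv_add_single_of_forall_add_single {F : Type*} [NormedAddCommGroup F]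
    [NormedSpace ℝ F] {c : 𝕋³ → F}
    (hinv : ∀ (s : UnitAddCircle) (x : 𝕋³), c (x + Pi.single (2 : Fin 3) s) = c x) (i : Fin 3)
    (s : UnitAddCircle) (x : 𝕋³) :
    partialDeriv i c (x + Pi.single (2 : Fin 3) s) = partialDeriv i c x := by
  unfold partialDeriv lineDeriv
  congr 1
  funext t
  rw [add_right_comm, hinv]

/-- Component `L²` norms are dominated by the vector `L²` norm. [folklore] -/
theorem lintegral_enorm_apply_sq_le (v : 𝕋³ → E³) (l : Fin 3) :
    ∫⁻ x, ‖v x l‖ₑ ^ 2 ≤ ∫⁻ x, ‖v x‖ₑ ^ 2 :=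
  lintegral_mono fun x => by
    gcongr
    rw [← ofReal_norm, ← ofReal_norm]
    exact ENNReal.ofReal_le_ofReal (PiLp.norm_apply_le (v x) l)

/-- Component `H¹` norms are dominated by the vector `H¹` norm. [folklore] -/
theorem lintegral_enorm_apply_sq_add_sum_le {v : 𝕋³ → E³} (hv : IsContDiff 1 v) (l : Fin 3) :
    (∫⁻ x, ‖v x l‖ₑ ^ 2) + ∑ m, ∫⁻ x, ‖partialDeriv m (fun y => v y l) x‖ₑ ^ 2 ≤
      (∫⁻ x, ‖v x‖ₑ ^ 2) + ∑ m, ∫⁻ x, ‖partialDeriv m v x‖ₑ ^ 2 := by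
  refine add_le_add (lintegral_enorm_apply_sq_le v l) (Finset.sum_le_sum fun m _ => ?_)
  simp_rw [partialDeriv_apply_coord hv]
  exact lintegral_enorm_apply_sq_le _ l

/-- **From scalar pairings to the convective form**: if all nine pairings `∫ aᵢ bⱼ ∂ᵢcⱼ` are
bounded by `K`, then `|∫ ⟪b, (a·∇)c⟫| ≤ 9K` (`⟪b, (a·∇)c⟫ = ∑ᵢⱼ aᵢ bⱼ ∂ᵢcⱼ`). [folklore] -/
theorem enorm_integral_inner_convect_le_of_forall {a b c : 𝕋³ → E³} (ha : IsSmooth a)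
    (hb : IsSmooth b) (hc : IsSmooth c) {K : ℝ≥0∞}
    (hK : ∀ i j, ‖∫ x, a x i * b x j * partialDeriv i c x j‖ₑ ≤ K) :
    ‖∫ x, ⟪b x, convect a c x⟫_ℝ‖ₑ ≤ 9 * K := by
  have hc1 : IsContDiff 1 c := hc.isContDiff (by simp)
  have hint : ∀ i j, Integrable (fun x => a x i * b x j * partialDeriv i c x j) volume := fun i j =>
    (((ha.apply i).continuous.mul (hb.apply j).continuous).mul
      ((hc.partialDeriv i).apply j).continuous).integrable_unitAddTorus
  have hexp : ∀ x, ⟪b x, convect a c x⟫_ℝ = ∑ i, ∑ j, a x i * b x j * partialDeriv i c x j := by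
    intro x
    rw [convect, fderiv_apply_eq_sum_partialDeriv hc1, inner_sum]
    refine Finset.sum_congr rfl fun i _ => ?_
    rw [real_inner_smul_right, PiLp.inner_apply, Finset.mul_sum]
    refine Finset.sum_congr rfl fun j _ => ?_
    simp only [RCLike.inner_apply, conj_trivial]
    ring
  simp_rw [hexp]
  rw [integral_finsetSum _ fun i _ => integrable_finsetSum _ fun j _ => hint i j]
  calc ‖∑ i, ∫ x, ∑ j, a x i * b x j * partialDeriv i c x j‖ₑ
      ≤ ∑ i, ‖∫ x, ∑ j, a x i * b x j * partialDeriv i c x j‖ₑ := enorm_sum_le _ _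
    _ ≤ ∑ i : Fin 3, ∑ j : Fin 3, K := by
        refine Finset.sum_le_sum fun i _ => ?_
        rw [integral_finsetSum _ fun j _ => hint i j]
        exact (enorm_sum_le _ _).trans (Finset.sum_le_sum fun j _ => hK i j)
    _ = 9 * K := by
        simp only [Finset.sum_const, Finset.card_univ, Fintype.card_fin]
        norm_num
        ring

/-- **The anisotropic estimate for the convective trilinear form, derivative on the invariant
field.** For smooth vector fields `a b c : T³ → ℝ³` with `c` independent of the third
coordinate,
`|∫ ⟪b, (a·∇)c⟫| ≤ 9C ‖a‖₂^{1/2}‖a‖_{H¹}^{1/2} ‖b‖₂^{1/2}‖b‖_{H¹}^{1/2} ‖∇c‖₂`,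
`C = anisotropicConst`, `‖a‖²_{H¹} = ∫‖a‖² + ∑ᵢ∫‖∂ᵢa‖²`, `‖∇c‖₂² = ∑ᵢ ∫‖∂ᵢc‖²` (the bound on the
term `((w·∇)…, u)` in Bardos–Lopes Filho–Niu–Nussenzveig Lopes–Titi 2013, proof of Thm. 3.1,
here with the derivative carried by the `x₃`-independent field). [cite: BardosEtAl2013, Thm. 3.1 (proof)] -/
theorem enorm_integral_inner_convect_le_anisotropic {a b c : 𝕋³ → E³} (ha : IsSmooth a)
    (hb : IsSmooth b) (hc : IsSmooth c)
    (hinv : ∀ (s : UnitAddCircle) (x : 𝕋³), c (x + Pi.single (2 : Fin 3) s) = c x) :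
    ‖∫ x, ⟪b x, convect a c x⟫_ℝ‖ₑ ≤
      9 * anisotropicConst * ((∫⁻ x, ‖a x‖ₑ ^ 2) ^ (1 / 4 : ℝ) *
            ((∫⁻ x, ‖a x‖ₑ ^ 2) + ∑ i, ∫⁻ x, ‖partialDeriv i a x‖ₑ ^ 2) ^ (1 / 4 : ℝ)) *
          ((∫⁻ x, ‖b x‖ₑ ^ 2) ^ (1 / 4 : ℝ) *
            ((∫⁻ x, ‖b x‖ₑ ^ 2) + ∑ i, ∫⁻ x, ‖partialDeriv i b x‖ₑ ^ 2) ^ (1 / 4 : ℝ)) *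
          (∑ i, ∫⁻ x, ‖partialDeriv i c x‖ₑ ^ 2) ^ (1 / 2 : ℝ) := by
  have ha1 : IsContDiff 1 a := ha.isContDiff (by simp)
  have hb1 : IsContDiff 1 b := hb.isContDiff (by simp)
  rw [mul_assoc, mul_assoc, mul_assoc 9]
  refine enorm_integral_inner_convect_le_of_forall ha hb hc fun i j => ?_
  have hinv' : ∀ (s : UnitAddCircle) (x : 𝕋³),
      partialDeriv i c (x + Pi.single (2 : Fin 3) s) j = partialDeriv i c x j := fun s x => by
    rw [partialDeriv_add_single_of_forall_add_single hinv]
  have hGc : ∫⁻ x, ‖partialDeriv i c x j‖ₑ ^ 2 ≤ ∑ i, ∫⁻ x, ‖partialDeriv i c x‖ₑ ^ 2 :=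
    (lintegral_enorm_apply_sq_le (partialDeriv i c) j).trans
      (Finset.single_le_sum (f := fun i => ∫⁻ x, ‖partialDeriv i c x‖ₑ ^ 2) (fun _ _ => zero_le)
        (Finset.mem_univ i))
  calc ‖∫ x, a x i * b x j * partialDeriv i c x j‖ₑ
      ≤ ∫⁻ x, ‖a x i * b x j * partialDeriv i c x j‖ₑ := enorm_integral_le_lintegral_enorm _
    _ = ∫⁻ x, ‖a x i‖ₑ * ‖b x j‖ₑ * ‖partialDeriv i c x j‖ₑ :=
        lintegral_congr fun x => by rw [enorm_mul, enorm_mul]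
    _ ≤ anisotropicConst * ((∫⁻ x, ‖a x i‖ₑ ^ 2) ^ (1 / 4 : ℝ) *
            ((∫⁻ x, ‖a x i‖ₑ ^ 2) + ∑ m, ∫⁻ x, ‖partialDeriv m (fun y => a y i) x‖ₑ ^ 2) ^ (1 / 4 : ℝ)) *
          ((∫⁻ x, ‖b x j‖ₑ ^ 2) ^ (1 / 4 : ℝ) *
            ((∫⁻ x, ‖b x j‖ₑ ^ 2) + ∑ m, ∫⁻ x, ‖partialDeriv m (fun y => b y j) x‖ₑ ^ 2) ^ (1 / 4 : ℝ)) *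
          (∫⁻ x, ‖partialDeriv i c x j‖ₑ ^ 2) ^ (1 / 2 : ℝ) :=
        lintegral_mul_mul_le_anisotropic (ha.apply i) (hb.apply j)
          ((hc.partialDeriv i).apply j).continuous.measurable hinv'
    _ ≤ anisotropicConst * ((∫⁻ x, ‖a x‖ₑ ^ 2) ^ (1 / 4 : ℝ) *
            ((∫⁻ x, ‖a x‖ₑ ^ 2) + ∑ m, ∫⁻ x, ‖partialDeriv m a x‖ₑ ^ 2) ^ (1 / 4 : ℝ)) *
          ((∫⁻ x, ‖b x‖ₑ ^ 2) ^ (1 / 4 : ℝ) *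
            ((∫⁻ x, ‖b x‖ₑ ^ 2) + ∑ m, ∫⁻ x, ‖partialDeriv m b x‖ₑ ^ 2) ^ (1 / 4 : ℝ)) *
          (∑ i, ∫⁻ x, ‖partialDeriv i c x‖ₑ ^ 2) ^ (1 / 2 : ℝ) := by
        refine mul_le_mul' (mul_le_mul' (mul_le_mul' le_rfl (mul_le_mul' ?_ ?_)) (mul_le_mul' ?_ ?_)) ?_
        · exact ENNReal.rpow_le_rpow (lintegral_enorm_apply_sq_le a i) (by norm_num)
        · exact ENNReal.rpow_le_rpow (lintegral_enorm_apply_sq_add_sum_le ha1 i) (by norm_num)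
        · exact ENNReal.rpow_le_rpow (lintegral_enorm_apply_sq_le b j) (by norm_num)
        · exact ENNReal.rpow_le_rpow (lintegral_enorm_apply_sq_add_sum_le hb1 j) (by norm_num)
        · exact ENNReal.rpow_le_rpow hGc (by norm_num)
    _ = _ := by ring

/-- **The anisotropic estimate for the convective trilinear form, two invariant fields.** For
smooth vector fields `a b c : T³ → ℝ³` with `a` and `b` independent of the third coordinate,
`|∫ ⟪b, (a·∇)c⟫| ≤ 9C ‖a‖₂^{1/2}‖a‖_{H¹}^{1/2} ‖b‖₂^{1/2}‖b‖_{H¹}^{1/2} ‖∇c‖₂`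
(`lintegral_mul_mul_le_anisotropic'` on the nine pairings). [cite: BardosEtAl2013, Thm. 3.1 (proof)] -/
theorem enorm_integral_inner_convect_le_anisotropic' {a b c : 𝕋³ → E³} (ha : IsSmooth a)
    (hb : IsSmooth b) (hc : IsSmooth c)
    (hainv : ∀ (s : UnitAddCircle) (x : 𝕋³), a (x + Pi.single (2 : Fin 3) s) = a x)
    (hbinv : ∀ (s : UnitAddCircle) (x : 𝕋³), b (x + Pi.single (2 : Fin 3) s) = b x) :
    ‖∫ x, ⟪b x, convect a c x⟫_ℝ‖ₑ ≤
      9 * anisotropicConst * ((∫⁻ x, ‖a x‖ₑ ^ 2) ^ (1 / 4 : ℝ) *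
            ((∫⁻ x, ‖a x‖ₑ ^ 2) + ∑ i, ∫⁻ x, ‖partialDeriv i a x‖ₑ ^ 2) ^ (1 / 4 : ℝ)) *
          ((∫⁻ x, ‖b x‖ₑ ^ 2) ^ (1 / 4 : ℝ) *
            ((∫⁻ x, ‖b x‖ₑ ^ 2) + ∑ i, ∫⁻ x, ‖partialDeriv i b x‖ₑ ^ 2) ^ (1 / 4 : ℝ)) *
          (∑ i, ∫⁻ x, ‖partialDeriv i c x‖ₑ ^ 2) ^ (1 / 2 : ℝ) := by
  have ha1 : IsContDiff 1 a := ha.isContDiff (by simp)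
  have hb1 : IsContDiff 1 b := hb.isContDiff (by simp)
  rw [mul_assoc, mul_assoc, mul_assoc 9]
  refine enorm_integral_inner_convect_le_of_forall ha hb hc fun i j => ?_
  have hGc : ∫⁻ x, ‖partialDeriv i c x j‖ₑ ^ 2 ≤ ∑ i, ∫⁻ x, ‖partialDeriv i c x‖ₑ ^ 2 :=
    (lintegral_enorm_apply_sq_le (partialDeriv i c) j).trans
      (Finset.single_le_sum (f := fun i => ∫⁻ x, ‖partialDeriv i c x‖ₑ ^ 2) (fun _ _ => zero_le)
        (Finset.mem_univ i))
  calc ‖∫ x, a x i * b x j * partialDeriv i c x j‖ₑ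
      ≤ ∫⁻ x, ‖a x i * b x j * partialDeriv i c x j‖ₑ := enorm_integral_le_lintegral_enorm _
    _ = ∫⁻ x, ‖a x i‖ₑ * ‖b x j‖ₑ * ‖partialDeriv i c x j‖ₑ :=
        lintegral_congr fun x => by rw [enorm_mul, enorm_mul]
    _ ≤ anisotropicConst * ((∫⁻ x, ‖a x i‖ₑ ^ 2) ^ (1 / 4 : ℝ) *
            ((∫⁻ x, ‖a x i‖ₑ ^ 2) + ∑ m, ∫⁻ x, ‖partialDeriv m (fun y => a y i) x‖ₑ ^ 2) ^ (1 / 4 : ℝ)) *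
          ((∫⁻ x, ‖b x j‖ₑ ^ 2) ^ (1 / 4 : ℝ) *
            ((∫⁻ x, ‖b x j‖ₑ ^ 2) + ∑ m, ∫⁻ x, ‖partialDeriv m (fun y => b y j) x‖ₑ ^ 2) ^ (1 / 4 : ℝ)) *
          (∫⁻ x, ‖partialDeriv i c x j‖ₑ ^ 2) ^ (1 / 2 : ℝ) :=
        lintegral_mul_mul_le_anisotropic' (ha.apply i) (hb.apply j) (fun s x => by rw [hainv])
          (fun s x => by rw [hbinv]) ((hc.partialDeriv i).apply j).continuous.measurable
    _ ≤ anisotropicConst * ((∫⁻ x, ‖a x‖ₑ ^ 2) ^ (1 / 4 : ℝ) *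
            ((∫⁻ x, ‖a x‖ₑ ^ 2) + ∑ m, ∫⁻ x, ‖partialDeriv m a x‖ₑ ^ 2) ^ (1 / 4 : ℝ)) *
          ((∫⁻ x, ‖b x‖ₑ ^ 2) ^ (1 / 4 : ℝ) *
            ((∫⁻ x, ‖b x‖ₑ ^ 2) + ∑ m, ∫⁻ x, ‖partialDeriv m b x‖ₑ ^ 2) ^ (1 / 4 : ℝ)) *
          (∑ i, ∫⁻ x, ‖partialDeriv i c x‖ₑ ^ 2) ^ (1 / 2 : ℝ) := by
        refine mul_le_mul' (mul_le_mul' (mul_le_mul' le_rfl (mul_le_mul' ?_ ?_)) (mul_le_mul' ?_ ?_)) ?_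
        · exact ENNReal.rpow_le_rpow (lintegral_enorm_apply_sq_le a i) (by norm_num)
        · exact ENNReal.rpow_le_rpow (lintegral_enorm_apply_sq_add_sum_le ha1 i) (by norm_num)
        · exact ENNReal.rpow_le_rpow (lintegral_enorm_apply_sq_le b j) (by norm_num)
        · exact ENNReal.rpow_le_rpow (lintegral_enorm_apply_sq_add_sum_le hb1 j) (by norm_num)
        · exact ENNReal.rpow_le_rpow hGc (by norm_num)
    _ = _ := by ring

end Trilinear

end Literature.Analysis.FunctionSpaces.Torus

end
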